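import Literature.AlgebraicGeometry.Motives.HodgeLieCommutantBlocks
import Literature.AlgebraicGeometry.Motives.HodgeThetaNoRealEigenvector
import Literature.AlgebraicGeometry.Motives.ConjStableRealBasis
import Literature.RepresentationTheory.GeneralLinear.Sl2PlacesRationalHull
import Mathlib.Algebra.DirectSum.LinearMap
import Mathlib.Data.Matrix.Block
import Mathlib.LinearAlgebra.Matrix.ToLin
import HarnessLib

/-!
# The Lie algebra of the Hodge group is `𝔰𝔭_E(V, ψ) = ⊕_σ 𝔰𝔩(T_σ)` when the Hodge endomorphisms are self-adjoint with real two-dimensional eigenblocks (Hazama 1983 §3; Ribet 1983) — the Hodge side of `Sl2PlacesRationalHull`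

Pure `ℚ`-Hodge structures `H` of weight `n` on a finite-dimensional `V` (the tree's
`Motives.HodgeStructure`), with `E = End_Hdg(V)` (`H.endAlg`), the eigenblocks `T_σ = H.eigenBlock σ`
of the characters `σ : E → ℂ` (`Motives/ZarhinHodgeGroupBlocks`), the Lie algebra
`Lie Hdg(H) = H.hodgeLie ⊆ End_ℚ(V)` of the Hodge group and its complexification `H.hodgeLieC`
(`Motives/ZarhinHodgeGroupLieAlgebra`).

**Theorem** (`mem_hodgeLieC_iff_commute_and_skew`, `mem_hodgeLie_iff_commute_and_skew`,
`mem_hodgeLieC_iff_mapsTo_and_skew`). Let `n` be ODD, `ψ` a polarization of `H` for which every Hodge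
endomorphism is `ψ`-self-adjoint (the Rosati involution is the identity on `E`), and
`σ_i : E → ℂ` (`i ∈ ι`, finite) REAL characters whose blocks `T_{σ_i}` are TWO-dimensional and form an
internal direct sum `V_ℂ = ⊕_i T_{σ_i}`. Then
* `Lie Hdg(H) ⊗ ℂ = {Y ∈ End_ℂ(V_ℂ) : Y commutes with E ⊗ ℂ and ψ_ℂ(Yx, y) + ψ_ℂ(x, Yy) = 0}`
  `= ⊕_i 𝔰𝔭(T_{σ_i}, ψ_ℂ) = ⊕_i 𝔰𝔩(T_{σ_i})`, and
* `Lie Hdg(H) = {X ∈ End_ℚ(V) : X commutes with E and ψ(Xv, w) + ψ(v, Xw) = 0} = 𝔰𝔭_E(V, ψ)`.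

For `H = H¹(X, ℚ)` of an abelian variety `X` with `End⁰(X) = E` a totally real field of degree
`dim X` (real multiplication of relative dimension one; the `σ_i` are the real places of `E`) this is
Hazama's computation "`dim_ℂ V_i = 2` for all `i`, and `p_i(𝔥) = 𝔰𝔩₂`", "`𝔥 = 𝔰𝔩₂ × ⋯ × 𝔰𝔩₂` (k times)
where the `i`-th component acts on `V_i ⊕ ⋯ ⊕ V_i` diagonally" (Hazama 1983, §3 pp. 305–306, through
Ribet's lemma Prop. (2.6) and Goursat's Lemma (3.1)), i.e. `Hg(X) = R_{E/ℚ} SL_{2,E}` (Ribet 1983);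
the hypotheses also cover `E` not a field, e.g. `H¹` of a product of pairwise non-isogenous elliptic
curves without complex multiplication (`E = ℚ × ⋯ × ℚ`, `Hg = SL₂ × ⋯ × SL₂`).

**Proof** (§1–§5). In real bases `b_i` of the blocks (`ConjStableRealBasis`), the blocks of the
rational operators `X ∈ Lie Hdg` are REAL `2 × 2` matrices (§1′), trace-free because `X_ℂ` is
`ψ_ℂ`-skew and `ψ_ℂ` restricts to a non-degenerate alternating form on each block (§2: blocks of
distinct characters are `ψ_ℂ`-orthogonal by self-adjointness). The set `S` of real block families of
`Lie Hdg` is bracket-closed, and the tree's `J`-side theorem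
`RepresentationTheory/GeneralLinear/Sl2PlacesRationalHull.mem_span_of_places_of_forall_trace_eq_zero`
(`F = ℝ`, `K = ℂ`, `J` = the blocks of the Hodge operator `Θ ∈ Lie Hdg ⊗ ℂ`) applies once its three
hypotheses are verified (§3): (i) no `J_k` has a real eigenline — a real eigenvector of `Θ` is
impossible in odd weight (`HodgeThetaNoRealEigenvector`); (a) at every block two elements of `Lie Hdg`
have non-commuting blocks — otherwise the operator equal to `Θ` on `T_{σ_k}` and `0` elsewhere commutes
with `Lie Hdg`, hence lies in `E ⊗ ℂ` (commutant theorem `mem_span_endAlg_of_forall_commute`), hence is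
a scalar on `T_{σ_k}`, and `Θ` would have a real eigenvector; (b) no graph position — a conjugating
matrix `g` gives an intertwiner `T_{σ_k} → T_{σ_i}` commuting with `Lie Hdg`, which vanishes
(`HodgeLieCommutantBlocks`), so `g = 0`. Hence every real slotwise trace-free family is a real
combination of real blocks of `Lie Hdg` (§4), and re-assembling block diagonal operators gives the
theorem (§5); the rational form follows because `X ∈ Lie Hdg ↔ X_ℂ ∈ Lie Hdg ⊗ ℂ`
(`tensorSpaceToBaseChange_injective`).

Research context (cell `pub-hodge-ring2`, Literature lane, real-multiplication programme R2a; HONEST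
FRAMING: a research route conditional on HC_CM; not a corollary; Q11.4-sentence-2 already refuted in
dim ≥ 3): this file is UNCONDITIONAL Hodge–Lie linear algebra, a formalisation of a published
computation, and no step towards a summit statement. Definitions: only the coordinate bookkeeping of
§1 (`RealPlaces.blockMat`, `RealPlaces.assemble`, `RealPlaces.intertwiner`, `RealPlaces.realBlocks`);
no named fact (D-0026); axioms standard.

## References

* [Hazama1983] F. Hazama, *Algebraic cycles on abelian varieties with many real endomorphisms*,
  Tôhoku Math. J. 35 (1983) 303–308 (held: `paper:doi-10-2748-tmj-1178229056`): Thm. (1.1) p. 303,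
  Prop. (2.6) p. 304 (Ribet's lemma), §3 pp. 305–306 ("`V_i` … mutually non-isomorphic `𝔥`-modules",
  "`dim_ℂ V_i = 2` for all `i`, and `p_i(𝔥) = 𝔰𝔩₂`", Lemma (3.1) (Goursat), "`𝔥 = 𝔰𝔩₂ × ⋯ × 𝔰𝔩₂`").
  [cite: Hazama1983, Thm. (1.1), Prop. (2.6), §3 (pp. 305–306), Lemma (3.1)]
* [Ribet1983] K. A. Ribet, *Hodge classes on certain types of abelian varieties*, Amer. J. Math. 105
  (1983) 523–538, Thm. 0–1 (`Hg = R_{E/ℚ} SL₂` in relative dimension one). [cite: Ribet1983, Thm. 0–1]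
* [MoonenZarhin1999LowDim] B. J. J. Moonen, Yu. G. Zarhin, Math. Ann. 315 (1999) 711–733, §3 (3.1)
  (Hodge groups of abelian varieties with `End⁰` totally real). [cite: MoonenZarhin1999LowDim, §3 (3.1)]
* [Zarhin1983HodgeGroupsK3] Yu. G. Zarhin, *Hodge groups of K3 surfaces*, J. reine angew. Math. 341
  (1983), §2 (commutant of the Hodge group; blocks `T_σ`). [cite: Zarhin1983HodgeGroupsK3, §2]
* [Huybrechts2016K3] D. Huybrechts, *Lectures on K3 Surfaces* (CUP 2016), §3.3.4 (p. 66), Thm. 3.3.9,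
  Rem. 3.3.14 (iii). [cite: Huybrechts2016K3, §3.3.4 and Rem. 3.3.14 (iii)]
* [Deligne1982HodgeCycles] P. Deligne, *Hodge cycles on abelian varieties*, LNM 900 (1982), I §3.
  [cite: Deligne1982HodgeCycles, I §3]
* [DeligneHodgeII1971] P. Deligne, *Théorie de Hodge II*, Publ. Math. IHÉS 40 (1971), 2.1.4 (real
  structure on `V_ℂ`). [cite: DeligneHodgeII1971, 2.1.4]
* [VoisinHodgeI2002] C. Voisin, *Hodge Theory and Complex Algebraic Geometry I* (2002), §7.1.2
  (polarizations, `(-1)^n`-symmetry). [cite: VoisinHodgeI2002, §7.1.2]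
-/

noncomputable section

open scoped TensorProduct

namespace Literature.AlgebraicGeometry.Motives

namespace HodgeStructure

/-! ### §1 Block calculus for an internal direct sum with rank-two bases (no Hodge theory) -/

namespace RealPlaces

section Generic

variable {K : Type*} [Field K] {W : Type*} [AddCommGroup W] [Module K W]
variable {ι : Type*} [Fintype ι] [DecidableEq ι] {T : ι → Submodule K W}
  (hint : DirectSum.IsInternal T) (b : ∀ i, Module.Basis (Fin 2) K (T i))

omit [Fintype ι] [DecidableEq ι] in
/-- Coordinates of an element of one summand along its basis. [folklore] -/
private theorem eq_sum_repr_of_mem (b : ∀ i, Module.Basis (Fin 2) K (T i)) {k : ι} {x : W}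
    (hx : x ∈ T k) : x = ∑ c, (b k).repr ⟨x, hx⟩ c • (b k c : W) := by
  conv_lhs => rw [show x = ((⟨x, hx⟩ : T k) : W) from rfl, ← (b k).sum_repr ⟨x, hx⟩]
  simp only [Submodule.coe_sum, Submodule.coe_smul]

omit [Fintype ι] in
/-- The vectors of the collected basis are the block basis vectors. [folklore] -/
private theorem collectedBasis_apply (k : ι) (c : Fin 2) :
    hint.collectedBasis b ⟨k, c⟩ = (b k c : W) := by
  simp [DirectSum.IsInternal.collectedBasis_coe]

/-- **The block extractor**: the diagonal blocks of the matrix of an endomorphism of `W` in the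
collected basis (`K`-linear in the endomorphism) — in coordinates, Hazama's projections
"`p_i : End V → End V_i (1 ≤ i ≤ k)`" (1983, §3 p. 305) for block-preserving operators.
[cite: Hazama1983, §3 (p. 305)] -/
def blockMat : Module.End K W →ₗ[K] (ι → Matrix (Fin 2) (Fin 2) K) where
  toFun f := Matrix.blockDiag'
    (LinearMap.toMatrix (hint.collectedBasis b) (hint.collectedBasis b) f)
  map_add' f g := by rw [map_add, Matrix.blockDiag'_add]
  map_smul' c f := by rw [map_smul, Matrix.blockDiag'_smul, RingHom.id_apply]

/-- Unfolding `blockMat`. [folklore] -/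
private theorem blockMat_def (f : Module.End K W) : blockMat hint b f = Matrix.blockDiag'
    (LinearMap.toMatrix (hint.collectedBasis b) (hint.collectedBasis b) f) := rfl

/-- Entries of the blocks: coordinates in the collected basis. [folklore] -/
private theorem blockMat_apply (f : Module.End K W) (k : ι) (a c : Fin 2) :
    blockMat hint b f k a c = (hint.collectedBasis b).repr (f (b k c)) ⟨k, a⟩ := by
  rw [blockMat_def, Matrix.blockDiag'_apply, LinearMap.toMatrix_apply, collectedBasis_apply]

/-- For a block-preserving `f` the entries are coordinates in the block basis. [cite: Hazama1983, §3 (p. 305)] -/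
theorem blockMat_apply_of_mapsTo {f : Module.End K W} (hf : ∀ i, Set.MapsTo f (T i) (T i))
    (k : ι) (a c : Fin 2) :
    blockMat hint b f k a c = (b k).repr ⟨f (b k c), hf k (b k c).2⟩ a := by
  rw [blockMat_apply, hint.collectedBasis_repr_of_mem b (hf k (b k c).2)]

/-- **Expansion of a block-preserving operator on a block basis vector.** [cite: Hazama1983, §3 (p. 305)] -/
theorem apply_basis_eq_sum {f : Module.End K W} (hf : ∀ i, Set.MapsTo f (T i) (T i))
    (k : ι) (c : Fin 2) : f (b k c) = ∑ a, blockMat hint b f k a c • (b k a : W) := by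
  conv_lhs => rw [eq_sum_repr_of_mem b (hf k (b k c).2)]
  simp only [blockMat_apply_of_mapsTo hint b hf]

/-- The matrix of a block-preserving operator is the block diagonal matrix of its blocks
(Mathlib's `toMatrix_directSum_collectedBasis_eq_blockDiagonal'`). [cite: Hazama1983, §3 (p. 305)] -/
theorem toMatrix_eq_blockDiagonal' {f : Module.End K W} (hf : ∀ i, Set.MapsTo f (T i) (T i)) :
    LinearMap.toMatrix (hint.collectedBasis b) (hint.collectedBasis b) f =
      Matrix.blockDiagonal' (blockMat hint b f) := by
  have h := LinearMap.toMatrix_directSum_collectedBasis_eq_blockDiagonal' hint hint b b hf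
  have h2 : blockMat hint b f = fun i => LinearMap.toMatrix (b i) (b i) (f.restrict (hf i)) := by
    rw [blockMat_def, h, Matrix.blockDiag'_blockDiagonal']
  rw [h2]
  exact h

/-- **Blocks multiply** for block-preserving operators. [cite: Hazama1983, §3 (p. 305)] -/
theorem blockMat_mul {f g : Module.End K W} (hf : ∀ i, Set.MapsTo f (T i) (T i))
    (hg : ∀ i, Set.MapsTo g (T i) (T i)) :
    blockMat hint b (f * g) = blockMat hint b f * blockMat hint b g := by
  rw [blockMat_def, LinearMap.toMatrix_mul, toMatrix_eq_blockDiagonal' hint b hf,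
    toMatrix_eq_blockDiagonal' hint b hg, ← Matrix.blockDiagonal'_mul,
    Matrix.blockDiag'_blockDiagonal']
  rfl

/-- **The assembling map**: a family of `2 × 2` blocks gives the block diagonal operator
(`K`-linear; "the `i`-th component acts on `V_i`", Hazama 1983 §3 p. 306). [cite: Hazama1983, §3 (p. 306)] -/
def assemble : (ι → Matrix (Fin 2) (Fin 2) K) →ₗ[K] Module.End K W where
  toFun M := Matrix.toLin (hint.collectedBasis b) (hint.collectedBasis b) (Matrix.blockDiagonal' M)
  map_add' M N := by rw [Matrix.blockDiagonal'_add, map_add]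
  map_smul' c M := by rw [Matrix.blockDiagonal'_smul, map_smul, RingHom.id_apply]

/-- Unfolding `assemble`. [folklore] -/
private theorem assemble_def (M : ι → Matrix (Fin 2) (Fin 2) K) : assemble hint b M =
    Matrix.toLin (hint.collectedBasis b) (hint.collectedBasis b) (Matrix.blockDiagonal' M) := rfl

/-- `blockMat ∘ assemble = id`. [cite: Hazama1983, §3 (pp. 305–306)] -/
theorem blockMat_assemble (M : ι → Matrix (Fin 2) (Fin 2) K) :
    blockMat hint b (assemble hint b M) = M := by
  rw [blockMat_def, assemble_def, LinearMap.toMatrix_toLin, Matrix.blockDiag'_blockDiagonal']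

/-- `assemble ∘ blockMat = id` on block-preserving operators. [cite: Hazama1983, §3 (pp. 305–306)] -/
theorem assemble_blockMat {f : Module.End K W} (hf : ∀ i, Set.MapsTo f (T i) (T i)) :
    assemble hint b (blockMat hint b f) = f := by
  rw [assemble_def, ← toMatrix_eq_blockDiagonal' hint b hf, Matrix.toLin_toMatrix]

/-- Two block-preserving operators with the same blocks are equal. [cite: Hazama1983, §3 (p. 305)] -/
theorem eq_of_blockMat_eq {f g : Module.End K W} (hf : ∀ i, Set.MapsTo f (T i) (T i))
    (hg : ∀ i, Set.MapsTo g (T i) (T i)) (h : blockMat hint b f = blockMat hint b g) : f = g := by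
  rw [← assemble_blockMat hint b hf, ← assemble_blockMat hint b hg, h]

/-- The assembled operator on a block basis vector. [cite: Hazama1983, §3 (p. 306)] -/
theorem assemble_apply_basis (M : ι → Matrix (Fin 2) (Fin 2) K) (k : ι) (c : Fin 2) :
    assemble hint b M (b k c) = ∑ a, M k a c • (b k a : W) := by
  rw [assemble_def, ← collectedBasis_apply hint b k c, Matrix.toLin_self,
    ← Finset.univ_sigma_univ, Finset.sum_sigma, Finset.sum_eq_single k]
  · simp only [Matrix.blockDiagonal'_apply_eq, collectedBasis_apply]
  · intro k' _ hk'
    simp only [Matrix.blockDiagonal'_apply_ne _ _ _ hk', zero_smul, Finset.sum_const_zero]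
  · intro h
    exact absurd (Finset.mem_univ k) h

/-- The assembled operator preserves every block. [cite: Hazama1983, §3 (p. 306)] -/
theorem assemble_mapsTo (M : ι → Matrix (Fin 2) (Fin 2) K) (i : ι) :
    Set.MapsTo (assemble hint b M) (T i) (T i) := by
  intro x hx
  rw [eq_sum_repr_of_mem b hx, map_sum]
  refine Submodule.sum_mem _ fun c _ => ?_
  rw [map_smul, assemble_apply_basis]
  exact Submodule.smul_mem _ _ (Submodule.sum_mem _ fun a _ => Submodule.smul_mem _ _ (b i a).2)

omit [Fintype ι] [DecidableEq ι] in
/-- Products of block-preserving operators are block-preserving. [folklore] -/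
private theorem mapsTo_mul {f g : Module.End K W} (hf : ∀ i, Set.MapsTo f (T i) (T i))
    (hg : ∀ i, Set.MapsTo g (T i) (T i)) (i : ι) : Set.MapsTo (f * g) (T i) (T i) :=
  fun _ hx => hf i (hg i hx)

/-- **The intertwiner** attached to a `2 × 2` matrix `g` and two indices `i, k`: it sends the
block basis vector `b k c` to `∑_a g_{ac} b i a` and kills all other block basis vectors.
[folklore] -/
def intertwiner (i k : ι) (g : Matrix (Fin 2) (Fin 2) K) : Module.End K W :=
  (hint.collectedBasis b).constr K fun j : Σ _ : ι, Fin 2 =>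
    if j.1 = k then ∑ a, g a j.2 • (b i a : W) else 0

omit [Fintype ι] in
/-- The intertwiner on the source block. [cite: Hazama1983, §3 (p. 306), Lemma (3.1)] -/
theorem intertwiner_apply_same (i k : ι) (g : Matrix (Fin 2) (Fin 2) K) (c : Fin 2) :
    intertwiner hint b i k g (b k c) = ∑ a, g a c • (b i a : W) := by
  rw [intertwiner, ← collectedBasis_apply hint b k c, Module.Basis.constr_basis, if_pos rfl]

omit [Fintype ι] in
/-- The intertwiner kills the other block basis vectors. [cite: Hazama1983, §3 (p. 306), Lemma (3.1)] -/
theorem intertwiner_apply_ne (i k : ι) {k' : ι} (hk : k' ≠ k) (g : Matrix (Fin 2) (Fin 2) K)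
    (c : Fin 2) : intertwiner hint b i k g (b k' c) = 0 := by
  rw [intertwiner, ← collectedBasis_apply hint b k' c, Module.Basis.constr_basis, if_neg hk]

omit [Fintype ι] in
/-- The intertwiner kills the other blocks. [cite: Hazama1983, §3 (p. 306), Lemma (3.1)] -/
theorem intertwiner_apply_of_mem_ne (i k : ι) {k' : ι} (hk : k' ≠ k)
    (g : Matrix (Fin 2) (Fin 2) K) {x : W} (hx : x ∈ T k') : intertwiner hint b i k g x = 0 := by
  rw [eq_sum_repr_of_mem b hx, map_sum]
  exact Finset.sum_eq_zero fun c _ => by rw [map_smul, intertwiner_apply_ne hint b i k hk, smul_zero]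

omit [Fintype ι] in
/-- The intertwiner carries the source block into the target block. [cite: Hazama1983, §3 (p. 306), Lemma (3.1)] -/
theorem intertwiner_mapsTo (i k : ι) (g : Matrix (Fin 2) (Fin 2) K) {x : W} (hx : x ∈ T k) :
    intertwiner hint b i k g x ∈ T i := by
  rw [eq_sum_repr_of_mem b hx, map_sum]
  refine Submodule.sum_mem _ fun c _ => ?_
  rw [map_smul, intertwiner_apply_same]
  exact Submodule.smul_mem _ _ (Submodule.sum_mem _ fun a _ => Submodule.smul_mem _ _ (b i a).2)

omit [Fintype ι] [DecidableEq ι] in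
/-- Re-arranging a double sum over `Fin 2`. [folklore] -/
private theorem sum_smul_sum_smul (P : Fin 2 → K) (Q : Fin 2 → Fin 2 → K) (v : Fin 2 → W) :
    ∑ d, P d • ∑ a, Q a d • v a = ∑ a, (∑ d, Q a d * P d) • v a := by
  simp_rw [Finset.smul_sum, smul_smul]
  rw [Finset.sum_comm]
  refine Finset.sum_congr rfl fun a _ => ?_
  rw [Finset.sum_smul]
  exact Finset.sum_congr rfl fun d _ => by rw [mul_comm]

/-- **The intertwiner commutes with a block-preserving operator in graph position**: if
`N_i g = g N_k` for the blocks `N` of `f`, then `T_g f = f T_g`. [cite: Hazama1983, §3 (p. 306), Lemma (3.1)] -/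
theorem intertwiner_comm (i k : ι) (g : Matrix (Fin 2) (Fin 2) K) {f : Module.End K W}
    (hf : ∀ j, Set.MapsTo f (T j) (T j))
    (hrel : blockMat hint b f i * g = g * blockMat hint b f k) :
    intertwiner hint b i k g * f = f * intertwiner hint b i k g := by
  refine (hint.collectedBasis b).ext fun j => ?_
  obtain ⟨k', c⟩ := j
  rw [Module.End.mul_apply, Module.End.mul_apply, collectedBasis_apply]
  by_cases hk : k' = k
  · subst hk
    rw [apply_basis_eq_sum hint b hf k' c, map_sum, intertwiner_apply_same, map_sum]
    simp_rw [map_smul, intertwiner_apply_same, apply_basis_eq_sum hint b hf i, sum_smul_sum_smul]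
    refine Finset.sum_congr rfl fun a _ => ?_
    congr 1
    have h := congrFun (congrFun hrel a) c
    rw [Matrix.mul_apply, Matrix.mul_apply] at h
    rw [← h]
  · rw [intertwiner_apply_of_mem_ne hint b i k hk g (hf k' (b k' c).2),
      intertwiner_apply_ne hint b i k hk, map_zero]

omit [Fintype ι] in
/-- If the intertwiner vanishes on the source block then `g = 0`. [cite: Hazama1983, §3 (p. 306), Lemma (3.1)] -/
theorem eq_zero_of_intertwiner_apply_eq_zero (i k : ι) (g : Matrix (Fin 2) (Fin 2) K)
    (h : ∀ c, intertwiner hint b i k g (b k c) = 0) : g = 0 := by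
  have hli : LinearIndependent K fun a => (b i a : W) :=
    (b i).linearIndependent.map' (T i).subtype (Submodule.ker_subtype _)
  ext a c
  have h1 := h c
  rw [intertwiner_apply_same] at h1
  exact Fintype.linearIndependent_iff.1 hli (fun a => g a c) h1 a

end Generic

/-! ### §1′ Real bases of the complexification: real operators have real blocks -/

section Real

universe u

variable {V : Type u} [AddCommGroup V] [Module ℚ V]
variable {ι : Type*} [Fintype ι] [DecidableEq ι]

/-- In a basis of real vectors, the coordinates of `conj x` are the conjugates of those of `x`.
[cite: DeligneHodgeII1971, 2.1.4] -/
theorem repr_conj_apply {J : Type*} [Fintype J] (B : Module.Basis J ℂ (ℂ ⊗[ℚ] V))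
    (hB : ∀ j, conj (B j) = B j) (x : ℂ ⊗[ℚ] V) (j : J) :
    B.repr (conj x) j = starRingEnd ℂ (B.repr x j) := by
  have hx : conj x = ∑ j, starRingEnd ℂ (B.repr x j) • B j := by
    conv_lhs => rw [← B.sum_repr x]
    rw [map_sum]
    simp_rw [conj_smul, hB]
  rw [hx, B.repr_sum_self]

/-- In a basis of real vectors, real vectors have real coordinates. [cite: DeligneHodgeII1971, 2.1.4] -/
theorem conj_repr_apply_of_conj_eq {J : Type*} [Fintype J] (B : Module.Basis J ℂ (ℂ ⊗[ℚ] V))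
    (hB : ∀ j, conj (B j) = B j) {x : ℂ ⊗[ℚ] V} (hx : conj x = x) (j : J) :
    starRingEnd ℂ (B.repr x j) = B.repr x j := by
  rw [← repr_conj_apply B hB x j, hx]

/-- A `ℂ`-combination with real coefficients of real vectors is real. [cite: DeligneHodgeII1971, 2.1.4] -/
theorem conj_sum_ofReal_smul {J : Type*} [Fintype J] (v : J → ℝ) (w : J → ℂ ⊗[ℚ] V)
    (hw : ∀ j, conj (w j) = w j) : conj (∑ j, ((v j : ℝ) : ℂ) • w j) = ∑ j, ((v j : ℝ) : ℂ) • w j := by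
  rw [map_sum]
  exact Finset.sum_congr rfl fun j _ => by rw [conj_smul, Complex.conj_ofReal, hw j]

/-- **The real blocks** of a rational operator `X`: the entrywise real parts of the blocks of
`X_ℂ` (which are real when the block bases are real, `realBlocks_map`). [folklore] -/
def realBlocks {T : ι → Submodule ℂ (ℂ ⊗[ℚ] V)} (hint : DirectSum.IsInternal T)
    (b : ∀ i, Module.Basis (Fin 2) ℂ (T i)) (X : Module.End ℚ V) : ι → Matrix (Fin 2) (Fin 2) ℝ :=
  fun k => (blockMat hint b (X.baseChange ℂ) k).map Complex.re

/-- Unfolding `realBlocks`. [folklore] -/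
private theorem realBlocks_apply {T : ι → Submodule ℂ (ℂ ⊗[ℚ] V)} (hint : DirectSum.IsInternal T)
    (b : ∀ i, Module.Basis (Fin 2) ℂ (T i)) (X : Module.End ℚ V) (k : ι) :
    realBlocks hint b X k = (blockMat hint b (X.baseChange ℂ) k).map Complex.re := rfl

/-- **In real block bases the blocks of a rational operator are real.** [cite: DeligneHodgeII1971, 2.1.4] -/
theorem conj_blockMat_baseChange {T : ι → Submodule ℂ (ℂ ⊗[ℚ] V)} (hint : DirectSum.IsInternal T)
    (b : ∀ i, Module.Basis (Fin 2) ℂ (T i)) (hb : ∀ i a, conj (b i a : ℂ ⊗[ℚ] V) = b i a)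
    (X : Module.End ℚ V) (k : ι) (a c : Fin 2) :
    starRingEnd ℂ (blockMat hint b (X.baseChange ℂ) k a c) = blockMat hint b (X.baseChange ℂ) k a c := by
  rw [blockMat_apply]
  refine conj_repr_apply_of_conj_eq (hint.collectedBasis b) (fun j => ?_) ?_ _
  · obtain ⟨i, a'⟩ := j
    rw [collectedBasis_apply]
    exact hb i a'
  · rw [conj_baseChange, hb]

/-- The real blocks complexify back to the blocks. [cite: DeligneHodgeII1971, 2.1.4] -/
theorem realBlocks_map {T : ι → Submodule ℂ (ℂ ⊗[ℚ] V)} (hint : DirectSum.IsInternal T)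
    (b : ∀ i, Module.Basis (Fin 2) ℂ (T i)) (hb : ∀ i a, conj (b i a : ℂ ⊗[ℚ] V) = b i a)
    (X : Module.End ℚ V) :
    (fun k => (realBlocks hint b X k).map (algebraMap ℝ ℂ)) = blockMat hint b (X.baseChange ℂ) := by
  funext k
  ext a c
  simp only [realBlocks_apply, Matrix.map_apply, Complex.coe_algebraMap]
  exact Complex.conj_eq_iff_re.1 (conj_blockMat_baseChange hint b hb X k a c)

/-- The real blocks complexify back to the blocks, slotwise. [cite: DeligneHodgeII1971, 2.1.4] -/
theorem realBlocks_map_apply {T : ι → Submodule ℂ (ℂ ⊗[ℚ] V)} (hint : DirectSum.IsInternal T)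
    (b : ∀ i, Module.Basis (Fin 2) ℂ (T i)) (hb : ∀ i a, conj (b i a : ℂ ⊗[ℚ] V) = b i a)
    (X : Module.End ℚ V) (k : ι) :
    (realBlocks hint b X k).map (algebraMap ℝ ℂ) = blockMat hint b (X.baseChange ℂ) k :=
  congrFun (realBlocks_map hint b hb X) k

end Real

end RealPlaces

/-! ### §2 The Hodge side: orthogonality and non-degeneracy on the blocks, trace-free blocks -/

section Hodge

open RealPlaces

universe u

variable {V : Type u} [AddCommGroup V] [Module ℚ V] [Module.Finite ℚ V] [HodgeTensorFacts.{u, u}]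
  {n : ℤ}
variable {ι : Type*} [Fintype ι] [DecidableEq ι]

omit [Module.Finite ℚ V] [HodgeTensorFacts.{u, u}] in
/-- **Blocks of distinct characters are `ψ_ℂ`-orthogonal when every Hodge endomorphism is
`ψ`-self-adjoint**: `σ(a) ψ_ℂ(x, y) = ψ_ℂ(a x, y) = ψ_ℂ(x, a y) = τ(a) ψ_ℂ(x, y)` (Hazama 1983 §3:
the decomposition `H¹(A, ℂ) = ⊕ V_i` under `End⁰ A ⊗ ℂ`; Zarhin 1983 §2). [cite: Hazama1983, §3 (p. 305)]
[cite: Zarhin1983HodgeGroupsK3, §2] -/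
theorem form_eq_zero_of_mem_eigenBlock_of_isAdjointPair (H : HodgeStructure V n) (ψ : H.Polarization)
    (hself : ∀ a : H.endAlg,
      LinearMap.IsAdjointPair ψ.form ψ.form (a : Module.End ℚ V) (a : Module.End ℚ V))
    {σ τ : H.endAlg →+* ℂ} (hστ : σ ≠ τ) {x y : ℂ ⊗[ℚ] V} (hx : x ∈ H.eigenBlock σ)
    (hy : y ∈ H.eigenBlock τ) : ψ.form.baseChange ℂ x y = 0 := by
  obtain ⟨a, ha⟩ : ∃ a : H.endAlg, σ a ≠ τ a := by
    by_contra h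
    push Not at h
    exact hστ (RingHom.ext h)
  have h1 := isAdjointPair_baseChange (hself a) x y
  rw [(H.mem_eigenBlock_iff σ x).1 hx a, (H.mem_eigenBlock_iff τ y).1 hy a, map_smul,
    LinearMap.smul_apply, map_smul, smul_eq_mul, smul_eq_mul] at h1
  have h2 : (σ a - τ a) * ψ.form.baseChange ℂ x y = 0 := by rw [sub_mul, h1, sub_self]
  exact (mul_eq_zero.1 h2).resolve_left (sub_ne_zero.2 ha)

omit [Module.Finite ℚ V] [HodgeTensorFacts.{u, u}] in
/-- In odd weight the complexified polarization is alternating: `ψ_ℂ(x, x) = 0`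
(`ψ` is `(-1)^n`-symmetric). [cite: VoisinHodgeI2002, §7.1.2] -/
theorem form_baseChange_self_eq_zero_of_odd (H : HodgeStructure V n) (hn : Odd n)
    (ψ : H.Polarization) (x : ℂ ⊗[ℚ] V) : ψ.form.baseChange ℂ x x = 0 := by
  have h := ψ.form_baseChange_swap x x
  rw [Int.negOnePow_odd n hn] at h
  have h2 : (((-1 : ℤˣ) : ℤ) : ℂ) = -1 := by norm_num
  rw [h2, neg_one_mul, eq_neg_iff_add_eq_zero, ← two_mul, mul_eq_zero] at h
  exact h.resolve_left two_ne_zero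

omit [Module.Finite ℚ V] [HodgeTensorFacts.{u, u}] in
/-- In odd weight `ψ_ℂ(y, x) = -ψ_ℂ(x, y)`. [cite: VoisinHodgeI2002, §7.1.2] -/
theorem form_baseChange_swap_of_odd (H : HodgeStructure V n) (hn : Odd n) (ψ : H.Polarization)
    (x y : ℂ ⊗[ℚ] V) : ψ.form.baseChange ℂ y x = -ψ.form.baseChange ℂ x y := by
  rw [ψ.form_baseChange_swap, Int.negOnePow_odd n hn]
  have h2 : (((-1 : ℤˣ) : ℤ) : ℂ) = -1 := by norm_num
  rw [h2, neg_one_mul]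

omit [Module.Finite ℚ V] [HodgeTensorFacts.{u, u}] [Fintype ι] in
/-- Characters whose blocks form an internal direct sum with non-zero summands are pairwise
distinct. [cite: Huybrechts2016K3, Rem. 3.3.14 (iii)] -/
theorem injective_of_isInternal_eigenBlock (H : HodgeStructure V n) (σ : ι → (H.endAlg →+* ℂ))
    (hint : DirectSum.IsInternal fun i => H.eigenBlock (σ i))
    (b : ∀ i, Module.Basis (Fin 2) ℂ (H.eigenBlock (σ i))) : Function.Injective σ := by
  intro k k' hkk'
  by_contra hne
  have hbot : H.eigenBlock (σ k) = ⊥ := by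
    have h := hint.submodule_iSupIndep.pairwiseDisjoint hne
    change Disjoint (H.eigenBlock (σ k)) (H.eigenBlock (σ k')) at h
    rw [← hkk'] at h
    exact disjoint_self.1 h
  have h0 : ((b k 0 : H.eigenBlock (σ k)) : ℂ ⊗[ℚ] V) = 0 :=
    (Submodule.mem_bot ℂ).1 (hbot.le (b k 0).2)
  exact (b k).ne_zero 0 ((Submodule.coe_eq_zero).1 h0)

omit [Module.Finite ℚ V] [HodgeTensorFacts.{u, u}] [Fintype ι] in
/-- **Non-degeneracy on a block**: `ψ_ℂ(b_k 0, b_k 1) ≠ 0` for a basis `(b_k 0, b_k 1)` of the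
block `T_{σ_k}` — the block is orthogonal to all other blocks and `ψ_ℂ` is alternating and
non-degenerate (Hazama 1983 §3, p. 305: "the skew symmetric non-degenerate bilinear form on the
`𝔥`-module `V`"). [cite: Hazama1983, §3 (p. 305)] -/
theorem form_basis_ne_zero (H : HodgeStructure V n) (hn : Odd n) (ψ : H.Polarization)
    (hself : ∀ a : H.endAlg,
      LinearMap.IsAdjointPair ψ.form ψ.form (a : Module.End ℚ V) (a : Module.End ℚ V))
    (σ : ι → (H.endAlg →+* ℂ)) (hint : DirectSum.IsInternal fun i => H.eigenBlock (σ i))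
    (b : ∀ i, Module.Basis (Fin 2) ℂ (H.eigenBlock (σ i))) (k : ι) :
    ψ.form.baseChange ℂ (b k 0 : ℂ ⊗[ℚ] V) (b k 1) ≠ 0 := by
  intro h0
  have hσ := injective_of_isInternal_eigenBlock H σ hint b
  have key : ∀ y, ψ.form.baseChange ℂ (b k 0 : ℂ ⊗[ℚ] V) y = 0 := by
    intro y
    have hy : y ∈ ⨆ i, H.eigenBlock (σ i) := by
      rw [hint.submodule_iSup_eq_top]
      exact Submodule.mem_top
    induction hy using Submodule.iSup_induction' with
    | mem i y hy =>
      by_cases hik : i = k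
      · subst hik
        rw [eq_sum_repr_of_mem b hy]
        simp only [Fin.sum_univ_two, map_add, map_smul, smul_eq_mul]
        rw [form_baseChange_self_eq_zero_of_odd H hn ψ, h0, mul_zero, mul_zero, add_zero]
      · exact form_eq_zero_of_mem_eigenBlock_of_isAdjointPair H ψ hself
          (fun h => hik (hσ h).symm) (b k 0).2 hy
    | zero => simp
    | add y y' _ _ hy hy' => rw [map_add, hy, hy', add_zero]
  exact (b k).ne_zero 0 ((Submodule.coe_eq_zero).1 (ψ.eq_zero_of_forall_form_eq_zero key))

omit [Module.Finite ℚ V] [HodgeTensorFacts.{u, u}] in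
/-- **Blocks of a block-preserving `ψ_ℂ`-skew operator are trace-free** (`𝔰𝔭₂ = 𝔰𝔩₂` on each
two-dimensional block with its non-degenerate alternating form `ψ_σ`; Hazama 1983 §3:
"`p_i(𝔥) = 𝔰𝔩₂`"). [cite: Hazama1983, §3 (pp. 305–306)] -/
theorem trace_blockMat_eq_zero (H : HodgeStructure V n) (hn : Odd n) (ψ : H.Polarization)
    (hself : ∀ a : H.endAlg,
      LinearMap.IsAdjointPair ψ.form ψ.form (a : Module.End ℚ V) (a : Module.End ℚ V))
    (σ : ι → (H.endAlg →+* ℂ)) (hint : DirectSum.IsInternal fun i => H.eigenBlock (σ i))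
    (b : ∀ i, Module.Basis (Fin 2) ℂ (H.eigenBlock (σ i))) {f : Module.End ℂ (ℂ ⊗[ℚ] V)}
    (hf : ∀ i, Set.MapsTo f (H.eigenBlock (σ i)) (H.eigenBlock (σ i)))
    (hskew : ∀ x y, ψ.form.baseChange ℂ (f x) y + ψ.form.baseChange ℂ x (f y) = 0) (k : ι) :
    (blockMat hint b f k).trace = 0 := by
  have hβ := form_basis_ne_zero H hn ψ hself σ hint b k
  have h := hskew (b k 0) (b k 1)
  rw [apply_basis_eq_sum hint b hf k 0, apply_basis_eq_sum hint b hf k 1] at h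
  simp only [Fin.sum_univ_two, map_add, map_smul, LinearMap.add_apply, LinearMap.smul_apply,
    smul_eq_mul] at h
  rw [form_baseChange_self_eq_zero_of_odd H hn ψ (b k 0 : ℂ ⊗[ℚ] V),
    form_baseChange_self_eq_zero_of_odd H hn ψ (b k 1 : ℂ ⊗[ℚ] V)] at h
  rw [Matrix.trace_fin_two]
  have h' : (blockMat hint b f k 0 0 + blockMat hint b f k 1 1) *
      ψ.form.baseChange ℂ (b k 0 : ℂ ⊗[ℚ] V) (b k 1) = 0 := by
    linear_combination h
  exact (mul_eq_zero.1 h').resolve_right hβ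

/-! ### §3 The hypotheses (i), (a), (b) of `Sl2PlacesRationalHull` -/

omit [Fintype ι] [DecidableEq ι] in
/-- Elements of `𝔥_ℂ` preserve the blocks (restatement of `apply_mem_eigenBlock_of_mem_hodgeLieC`
as `Set.MapsTo`). [cite: Zarhin1983HodgeGroupsK3, §2] -/
theorem mapsTo_of_mem_hodgeLieC (H : HodgeStructure V n) (σ : ι → (H.endAlg →+* ℂ))
    {Y : Module.End ℂ (ℂ ⊗[ℚ] V)} (hY : Y ∈ H.hodgeLieC) (i : ι) :
    Set.MapsTo Y (H.eigenBlock (σ i)) (H.eigenBlock (σ i)) :=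
  fun _ hx => H.apply_mem_eigenBlock_of_mem_hodgeLieC hY hx

omit [Module.Finite ℚ V] [HodgeTensorFacts.{u, u}] in
/-- **Hypothesis (i): the blocks of the Hodge operator have no real eigenline.** For `Θ` acting by
`2p - n` on `V^{p,n-p}` (block-preserving) and real block bases, `J_k = blockMat Θ k` has no
eigenvector with real coordinates: such a vector would be a non-zero REAL eigenvector of `Θ` in
`T_{σ_k}`, impossible in odd weight (`hodgeTheta_apply_ne_smul_of_conj_eq_self`; Hazama 1983 §3 /
Deligne I §3: `Θ` is purely imaginary). [cite: Hazama1983, §3 (pp. 305–306)]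
[cite: Deligne1982HodgeCycles, I §3] -/
theorem blockMat_hodgeTheta_mulVec_ne_smul (H : HodgeStructure V n) (hn : Odd n)
    (σ : ι → (H.endAlg →+* ℂ)) (hint : DirectSum.IsInternal fun i => H.eigenBlock (σ i))
    (b : ∀ i, Module.Basis (Fin 2) ℂ (H.eigenBlock (σ i)))
    (hb : ∀ i a, conj (b i a : ℂ ⊗[ℚ] V) = b i a) {Θ : Module.End ℂ (ℂ ⊗[ℚ] V)}
    (hΘ : ∀ p, ∀ x ∈ H.piece p (n - p), Θ x = ((2 * p - n : ℤ) : ℂ) • x)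
    (hΘT : ∀ i, Set.MapsTo Θ (H.eigenBlock (σ i)) (H.eigenBlock (σ i))) (k : ι) (v : Fin 2 → ℝ)
    (hv : v ≠ 0) (μ : ℂ) :
    (blockMat hint b Θ k).mulVec (fun a => algebraMap ℝ ℂ (v a)) ≠
      μ • fun a => algebraMap ℝ ℂ (v a) := by
  intro h
  obtain ⟨x, hx⟩ : ∃ x : ℂ ⊗[ℚ] V, x = ∑ a, ((v a : ℝ) : ℂ) • (b k a : ℂ ⊗[ℚ] V) := ⟨_, rfl⟩
  have hreal : conj x = x := by
    rw [hx]
    exact conj_sum_ofReal_smul v _ (hb k)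
  have hx0 : x ≠ 0 := by
    intro h0
    rw [hx] at h0
    have hli : LinearIndependent ℂ fun a => (b k a : ℂ ⊗[ℚ] V) :=
      (b k).linearIndependent.map' (H.eigenBlock (σ k)).subtype (Submodule.ker_subtype _)
    have h1 := Fintype.linearIndependent_iff.1 hli (fun a => ((v a : ℝ) : ℂ)) h0
    apply hv
    funext a
    exact_mod_cast h1 a
  have hcoef : ∀ a, (∑ d, blockMat hint b Θ k a d * ((v d : ℝ) : ℂ)) = μ * ((v a : ℝ) : ℂ) := by
    intro a
    have h1 := congrFun h a
    simp only [Matrix.mulVec, dotProduct, Pi.smul_apply, smul_eq_mul, Complex.coe_algebraMap] at h1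
    exact h1
  have hΘx : Θ x = μ • x := by
    rw [hx, map_sum]
    simp_rw [map_smul, apply_basis_eq_sum hint b hΘT k, sum_smul_sum_smul, hcoef, ← smul_smul,
      ← Finset.smul_sum]
  exact hodgeTheta_apply_ne_smul_of_conj_eq_self H hn hΘ hreal hx0 μ hΘx

omit [Module.Finite ℚ V] [HodgeTensorFacts.{u, u}] [Fintype ι] [DecidableEq ι] in
/-- Elements of `End_Hdg(V) ⊗ ℂ = span_ℂ {a_ℂ}` act on each block by a scalar. [cite: Huybrechts2016K3, Rem. 3.3.14 (iii)] -/
theorem exists_scalar_of_mem_span_endAlg (H : HodgeStructure V n) (τ : H.endAlg →+* ℂ)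
    {P : Module.End ℂ (ℂ ⊗[ℚ] V)}
    (hP : P ∈ Submodule.span ℂ ((fun a : Module.End ℚ V => a.baseChange ℂ) '' (H.endAlg : Set _))) :
    ∃ c : ℂ, ∀ x ∈ H.eigenBlock τ, P x = c • x := by
  induction hP using Submodule.span_induction with
  | mem Z hZ =>
    obtain ⟨a, ha, rfl⟩ := hZ
    exact ⟨τ ⟨a, ha⟩, fun x hx => (H.mem_eigenBlock_iff τ x).1 hx ⟨a, ha⟩⟩
  | zero => exact ⟨0, fun x _ => by rw [LinearMap.zero_apply, zero_smul]⟩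
  | add Z Z' _ _ hZ hZ' =>
    obtain ⟨c, hc⟩ := hZ
    obtain ⟨c', hc'⟩ := hZ'
    exact ⟨c + c', fun x hx => by rw [LinearMap.add_apply, hc x hx, hc' x hx, add_smul]⟩
  | smul r Z _ hZ =>
    obtain ⟨c, hc⟩ := hZ
    exact ⟨r * c, fun x hx => by rw [LinearMap.smul_apply, hc x hx, smul_smul]⟩

omit [Fintype ι] [DecidableEq ι] in
/-- The `X_ℂ`, `X ∈ Lie Hdg`, preserve the blocks. [cite: Zarhin1983HodgeGroupsK3, §2] -/
theorem mapsTo_baseChange_of_mem_hodgeLie (H : HodgeStructure V n) (σ : ι → (H.endAlg →+* ℂ))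
    {X : Module.End ℚ V} (hX : X ∈ H.hodgeLie) (i : ι) :
    Set.MapsTo (X.baseChange ℂ) (H.eigenBlock (σ i)) (H.eigenBlock (σ i)) :=
  mapsTo_of_mem_hodgeLieC H σ (H.baseChange_mem_hodgeLieC hX) i

/-- **Hypothesis (a): at every block two elements of `Lie Hdg` have non-commuting blocks.**
Otherwise the slot-`k` blocks of `𝔥_ℂ` commute pairwise, in particular with `J_k = blockMat Θ k`;
then the operator `P` equal to `Θ` on `T_{σ_k}` and `0` on the other blocks commutes with `Lie Hdg`,
hence lies in `End_Hdg ⊗ ℂ` (commutant theorem `mem_span_endAlg_of_forall_commute`), hence is a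
scalar on `T_{σ_k}` — and `Θ` would have a real eigenvector. This is Hazama's "`p_i(𝔥) = 𝔰𝔩₂`"
(1983, §3 p. 306) in the tree's language; it needs no field hypothesis on `End_Hdg(V)`.
[cite: Hazama1983, §3 (pp. 305–306)] [cite: Zarhin1983HodgeGroupsK3, §2] -/
theorem exists_realBlocks_commutator_ne_zero (H : HodgeStructure V n) (hn : Odd n)
    (σ : ι → (H.endAlg →+* ℂ)) (hint : DirectSum.IsInternal fun i => H.eigenBlock (σ i))
    (b : ∀ i, Module.Basis (Fin 2) ℂ (H.eigenBlock (σ i)))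
    (hb : ∀ i a, conj (b i a : ℂ ⊗[ℚ] V) = b i a) (k : ι) :
    ∃ A ∈ realBlocks hint b '' (H.hodgeLie : Set (Module.End ℚ V)),
      ∃ B ∈ realBlocks hint b '' (H.hodgeLie : Set (Module.End ℚ V)), A k * B k - B k * A k ≠ 0 := by
  by_contra hcon
  push Not at hcon
  have hcomm : ∀ X ∈ H.hodgeLie, ∀ Y ∈ H.hodgeLie,
      blockMat hint b (X.baseChange ℂ) k * blockMat hint b (Y.baseChange ℂ) k =
        blockMat hint b (Y.baseChange ℂ) k * blockMat hint b (X.baseChange ℂ) k := by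
    intro X hX Y hY
    have h := congrArg (algebraMap ℝ ℂ).mapMatrix (hcon _ ⟨X, hX, rfl⟩ _ ⟨Y, hY, rfl⟩)
    rw [map_sub, map_mul, map_mul, map_zero, RingHom.mapMatrix_apply, RingHom.mapMatrix_apply,
      realBlocks_map_apply hint b hb, realBlocks_map_apply hint b hb] at h
    exact sub_eq_zero.1 h
  obtain ⟨Θ, hΘ⟩ := exists_hodgeTheta H
  have hΘC : Θ ∈ H.hodgeLieC := H.mem_hodgeLieC_of_forall_piece hΘ
  have hΘT := mapsTo_of_mem_hodgeLieC H σ hΘC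
  -- `J_k` commutes with the slot-`k` blocks of `Lie Hdg`
  have hJ : ∀ X ∈ H.hodgeLie, blockMat hint b Θ k * blockMat hint b (X.baseChange ℂ) k =
      blockMat hint b (X.baseChange ℂ) k * blockMat hint b Θ k := by
    intro X hX
    have key : ∀ Y ∈ H.hodgeLieC, blockMat hint b Y k * blockMat hint b (X.baseChange ℂ) k =
        blockMat hint b (X.baseChange ℂ) k * blockMat hint b Y k := by
      intro Y hY
      induction hY using Submodule.span_induction with
      | mem Z hZ =>
        obtain ⟨X', hX', rfl⟩ := hZ
        exact hcomm X' hX' X hX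
      | zero => rw [map_zero, Pi.zero_apply, zero_mul, mul_zero]
      | add Z Z' _ _ hZ hZ' => rw [map_add, Pi.add_apply, add_mul, mul_add, hZ, hZ']
      | smul c Z _ hZ => rw [map_smul, Pi.smul_apply, smul_mul_assoc, mul_smul_comm, hZ]
    exact key Θ hΘC
  -- the operator `P`: `Θ` on `T_{σ_k}`, zero elsewhere
  set P := assemble hint b (Pi.single k (blockMat hint b Θ k)) with hPdef
  have hPT : ∀ i, Set.MapsTo P (H.eigenBlock (σ i)) (H.eigenBlock (σ i)) := assemble_mapsTo hint b _
  have hPblk : blockMat hint b P = Pi.single k (blockMat hint b Θ k) := blockMat_assemble hint b _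
  have hPcomm : ∀ X ∈ H.hodgeLie, P * X.baseChange ℂ = X.baseChange ℂ * P := by
    intro X hX
    have hXT := mapsTo_baseChange_of_mem_hodgeLie H σ hX
    refine eq_of_blockMat_eq hint b (mapsTo_mul hPT hXT) (mapsTo_mul hXT hPT) ?_
    rw [blockMat_mul hint b hPT hXT, blockMat_mul hint b hXT hPT, hPblk]
    funext k'
    rw [Pi.mul_apply, Pi.mul_apply]
    by_cases hk : k' = k
    · rw [hk, Pi.single_eq_same]
      exact hJ X hX
    · rw [Pi.single_eq_of_ne hk, zero_mul, mul_zero]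
  obtain ⟨c, hc⟩ := exists_scalar_of_mem_span_endAlg H (σ k)
    (H.mem_span_endAlg_of_forall_commute hPcomm)
  have hPΘ : P (b k 0) = Θ (b k 0) := by
    rw [assemble_apply_basis, apply_basis_eq_sum hint b hΘT k 0]
    simp only [Pi.single_eq_same]
  have hne : (b k 0 : ℂ ⊗[ℚ] V) ≠ 0 := fun h => (b k).ne_zero 0 ((Submodule.coe_eq_zero).1 h)
  exact hodgeTheta_apply_ne_smul_of_conj_eq_self H hn hΘ (hb k 0) hne c
    (by rw [← hPΘ]; exact hc _ (b k 0).2)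

/-- **Hypothesis (b): the blocks of `Lie Hdg` are in graph position over no pair `k ≠ i`.** If
`N_i = g N_k g⁻¹` for all blocks `N` of elements of `Lie Hdg` and an invertible real `g`, the
intertwiner `T_g : T_{σ_k} → T_{σ_i}` commutes with `Lie Hdg`, hence vanishes on `T_{σ_k}`
(`eq_zero_of_forall_commute_of_mapsTo_eigenBlock`: the commutant is `End_Hdg ⊗ ℂ`, which preserves
blocks), forcing `g = 0`. Hazama 1983 §3: "the `𝔥`-modules `V_i` and `V_j` are not isomorphic".
[cite: Hazama1983, §3 (p. 306)] [cite: Zarhin1983HodgeGroupsK3, §2] -/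
theorem exists_realBlocks_ne_conj (H : HodgeStructure V n) (σ : ι → (H.endAlg →+* ℂ))
    (hint : DirectSum.IsInternal fun i => H.eigenBlock (σ i))
    (b : ∀ i, Module.Basis (Fin 2) ℂ (H.eigenBlock (σ i)))
    (hb : ∀ i a, conj (b i a : ℂ ⊗[ℚ] V) = b i a) (i k : ι) (hki : k ≠ i)
    (g g' : Matrix (Fin 2) (Fin 2) ℝ) (hgg' : g * g' = 1) (hg'g : g' * g = 1) :
    ∃ z ∈ realBlocks hint b '' (H.hodgeLie : Set (Module.End ℚ V)), z i ≠ g * z k * g' := by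
  by_contra hcon
  push Not at hcon
  set gc : Matrix (Fin 2) (Fin 2) ℂ := (algebraMap ℝ ℂ).mapMatrix g with hgc
  have hg'gc : (algebraMap ℝ ℂ).mapMatrix g' * gc = 1 := by rw [hgc, ← map_mul, hg'g, map_one]
  have hrel : ∀ X ∈ H.hodgeLie,
      blockMat hint b (X.baseChange ℂ) i * gc = gc * blockMat hint b (X.baseChange ℂ) k := by
    intro X hX
    have h := congrArg (algebraMap ℝ ℂ).mapMatrix (hcon _ ⟨X, hX, rfl⟩)
    rw [map_mul, map_mul, RingHom.mapMatrix_apply, RingHom.mapMatrix_apply (algebraMap ℝ ℂ)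
      (realBlocks hint b X k), realBlocks_map_apply hint b hb, realBlocks_map_apply hint b hb] at h
    rw [h, Matrix.mul_assoc, Matrix.mul_assoc, hg'gc, Matrix.mul_one]
  have hTcomm : ∀ X ∈ H.hodgeLie,
      intertwiner hint b i k gc * X.baseChange ℂ = X.baseChange ℂ * intertwiner hint b i k gc :=
    fun X hX => intertwiner_comm hint b i k gc (mapsTo_baseChange_of_mem_hodgeLie H σ hX) (hrel X hX)
  have hσ := injective_of_isInternal_eigenBlock H σ hint b
  have hzero : ∀ c, intertwiner hint b i k gc (b k c) = 0 := fun c =>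
    H.eq_zero_of_forall_commute_of_mapsTo_eigenBlock (σ := σ k) (τ := σ i)
      (fun h => hki (hσ h)) hTcomm (fun x hx => intertwiner_mapsTo hint b i k gc hx) (b k c).2
  have hg0 : gc = 0 := eq_zero_of_intertwiner_apply_eq_zero hint b i k gc hzero
  have h1 : (1 : Matrix (Fin 2) (Fin 2) ℂ) = 0 := by
    rw [← map_one (algebraMap ℝ ℂ).mapMatrix, ← hgg', map_mul, ← hgc, hg0, Matrix.zero_mul]
  exact one_ne_zero h1

/-! ### §4 Assembly: every real slotwise trace-free family is an `ℝ`-combination of real blocks of `Lie Hdg` -/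

/-- The `ψ_ℂ`-skewness of `X_ℂ` for `X ∈ Lie Hdg`, additive form. [cite: Huybrechts2016K3, Thm. 3.3.9 (proof, p. 67)] -/
theorem formBaseChange_add_eq_zero_of_mem_hodgeLie {H : HodgeStructure V n} (ψ : H.Polarization)
    {X : Module.End ℚ V} (hX : X ∈ H.hodgeLie) (x y : ℂ ⊗[ℚ] V) :
    ψ.form.baseChange ℂ (X.baseChange ℂ x) y + ψ.form.baseChange ℂ x (X.baseChange ℂ y) = 0 := by
  rw [formBaseChange_skew_of_mem_hodgeLieC ψ (H.baseChange_mem_hodgeLieC hX) x y, neg_add_cancel]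

/-- **Every real slotwise trace-free family of `2 × 2` matrices is a real linear combination of the
real blocks of elements of `Lie Hdg(H)`** — the tree's `mem_span_of_places_of_forall_trace_eq_zero`
(`Sl2PlacesRationalHull`, `F = ℝ`, `K = ℂ`) fed with (i) `blockMat_hodgeTheta_mulVec_ne_smul`,
(a) `exists_realBlocks_commutator_ne_zero`, (b) `exists_realBlocks_ne_conj`, `J = blockMat Θ`
(`Θ ∈ 𝔥_ℂ`), bracket-closedness of `Lie Hdg` and trace-freeness of its blocks. This is
"`𝔥 = 𝔰𝔩₂ × ⋯ × 𝔰𝔩₂` (k times) where the `i`-th component acts on `V_i ⊕ ⋯ ⊕ V_i` diagonally"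
(Hazama 1983, §3 p. 306). [cite: Hazama1983, §3 (pp. 305–306), Prop. (2.6), Lemma (3.1)]
[cite: MoonenZarhin1999LowDim, §3 (3.1)] -/
theorem mem_span_realBlocks_of_forall_trace_eq_zero (H : HodgeStructure V n) (hn : Odd n)
    (ψ : H.Polarization)
    (hself : ∀ a : H.endAlg,
      LinearMap.IsAdjointPair ψ.form ψ.form (a : Module.End ℚ V) (a : Module.End ℚ V))
    (σ : ι → (H.endAlg →+* ℂ)) (hint : DirectSum.IsInternal fun i => H.eigenBlock (σ i))
    (b : ∀ i, Module.Basis (Fin 2) ℂ (H.eigenBlock (σ i)))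
    (hb : ∀ i a, conj (b i a : ℂ ⊗[ℚ] V) = b i a) (A : ι → Matrix (Fin 2) (Fin 2) ℝ)
    (hA : ∀ k, (A k).trace = 0) :
    A ∈ Submodule.span ℝ (realBlocks hint b '' (H.hodgeLie : Set (Module.End ℚ V))) := by
  classical
  obtain ⟨Θ, hΘ⟩ := exists_hodgeTheta H
  have hΘC : Θ ∈ H.hodgeLieC := H.mem_hodgeLieC_of_forall_piece hΘ
  have hΘT := mapsTo_of_mem_hodgeLieC H σ hΘC
  refine Literature.RepresentationTheory.GeneralLinear.mem_span_of_places_of_forall_trace_eq_zero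
    (F := ℝ) (K := ℂ) (realBlocks hint b '' (H.hodgeLie : Set (Module.End ℚ V))) ?_ ?_
    (J := blockMat hint b Θ) ?_ ?_ ?_ ?_ A hA
  · -- bracket-closed: the real blocks of `XY - YX`
    rintro _ ⟨X, hX, rfl⟩ _ ⟨Y, hY, rfl⟩
    refine Submodule.subset_span ⟨X * Y - Y * X, H.commutator_mem_hodgeLie hX hY, ?_⟩
    have hXT := mapsTo_baseChange_of_mem_hodgeLie H σ hX
    have hYT := mapsTo_baseChange_of_mem_hodgeLie H σ hY
    funext k
    apply Matrix.map_injective (algebraMap ℝ ℂ).injective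
    change (realBlocks hint b (X * Y - Y * X) k).map (algebraMap ℝ ℂ) =
      ((realBlocks hint b X * realBlocks hint b Y - realBlocks hint b Y * realBlocks hint b X) k).map
        (algebraMap ℝ ℂ)
    rw [realBlocks_map_apply hint b hb, Pi.sub_apply, Pi.mul_apply, Pi.mul_apply,
      ← RingHom.mapMatrix_apply, map_sub, map_mul, map_mul, RingHom.mapMatrix_apply,
      RingHom.mapMatrix_apply, realBlocks_map_apply hint b hb, realBlocks_map_apply hint b hb,
      LinearMap.baseChange_sub, LinearMap.baseChange_mul, LinearMap.baseChange_mul, map_sub,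
      blockMat_mul hint b hXT hYT, blockMat_mul hint b hYT hXT]
    rfl
  · -- slotwise trace-free
    rintro _ ⟨X, hX, rfl⟩ k
    have h0 := trace_blockMat_eq_zero H hn ψ hself σ hint b (mapsTo_baseChange_of_mem_hodgeLie H σ hX)
      (formBaseChange_add_eq_zero_of_mem_hodgeLie ψ hX) k
    rw [Matrix.trace_fin_two] at h0 ⊢
    rw [realBlocks_apply, Matrix.map_apply, Matrix.map_apply, ← Complex.add_re, h0, Complex.zero_re]
  · -- `J` lies in the complex span of the images
    have hset : (fun A : ι → Matrix (Fin 2) (Fin 2) ℝ => fun k => (A k).map (algebraMap ℝ ℂ)) ''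
        (realBlocks hint b '' (H.hodgeLie : Set (Module.End ℚ V))) =
        (fun X : Module.End ℚ V => blockMat hint b (X.baseChange ℂ)) '' (H.hodgeLie : Set _) := by
      rw [Set.image_image]
      exact Set.image_congr fun X _ => realBlocks_map hint b hb X
    rw [hset]
    have key : ∀ Y ∈ H.hodgeLieC, blockMat hint b Y ∈ Submodule.span ℂ
        ((fun X : Module.End ℚ V => blockMat hint b (X.baseChange ℂ)) '' (H.hodgeLie : Set _)) := by
      intro Y hY
      induction hY using Submodule.span_induction with
      | mem Z hZ =>
        obtain ⟨X, hX, rfl⟩ := hZ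
        exact Submodule.subset_span ⟨X, hX, rfl⟩
      | zero => rw [map_zero]; exact Submodule.zero_mem _
      | add Z Z' _ _ hZ hZ' => rw [map_add]; exact Submodule.add_mem _ hZ hZ'
      | smul c Z _ hZ => rw [map_smul]; exact Submodule.smul_mem _ c hZ
    exact key Θ hΘC
  · exact fun k v hv μ => blockMat_hodgeTheta_mulVec_ne_smul H hn σ hint b hb hΘ hΘT k v hv μ
  · exact fun k => exists_realBlocks_commutator_ne_zero H hn σ hint b hb k
  · exact fun i k hki g g' hgg' hg'g => exists_realBlocks_ne_conj H σ hint b hb i k hki g g' hgg' hg'g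

/-! ### §5 The theorems: `Lie Hdg(H)_ℂ = {Y : Y E-linear, ψ_ℂ-skew}` and `Lie Hdg(H) = 𝔰𝔭_E(V, ψ)` -/

/-- **`Lie Hdg(H) ⊗ ℂ ⊇ ⊕_k 𝔰𝔩(T_{σ_k})` in coordinates.** With real block bases `b`: for every
family `N = (N_k)` of trace-free complex `2 × 2` matrices, the block diagonal operator
`assemble b N` (acting by `N_k` on `T_{σ_k}` in the basis `b_k`) lies in `Lie Hdg(H) ⊗ ℂ`: the real
and imaginary parts of `N` are real combinations of real blocks of elements of `Lie Hdg`
(`mem_span_realBlocks_of_forall_trace_eq_zero`), and `assemble` of the blocks of `X ∈ Lie Hdg` is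
`X_ℂ`. Hazama 1983 §3: "`𝔥 = 𝔰𝔩₂ × ⋯ × 𝔰𝔩₂`". [cite: Hazama1983, §3 (pp. 305–306)]
[cite: Ribet1983, Thm. 0–1] -/
theorem assemble_mem_hodgeLieC_of_forall_trace_eq_zero (H : HodgeStructure V n) (hn : Odd n)
    (ψ : H.Polarization)
    (hself : ∀ a : H.endAlg,
      LinearMap.IsAdjointPair ψ.form ψ.form (a : Module.End ℚ V) (a : Module.End ℚ V))
    (σ : ι → (H.endAlg →+* ℂ)) (hint : DirectSum.IsInternal fun i => H.eigenBlock (σ i))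
    (b : ∀ i, Module.Basis (Fin 2) ℂ (H.eigenBlock (σ i)))
    (hb : ∀ i a, conj (b i a : ℂ ⊗[ℚ] V) = b i a) (N : ι → Matrix (Fin 2) (Fin 2) ℂ)
    (hN : ∀ k, (N k).trace = 0) : assemble hint b N ∈ H.hodgeLieC := by
  classical
  -- the real and imaginary parts are trace-free
  obtain ⟨Nre, hNre⟩ : ∃ Nre : ι → Matrix (Fin 2) (Fin 2) ℝ,
    Nre = fun k => (N k).map Complex.re := ⟨_, rfl⟩
  obtain ⟨Nim, hNim⟩ : ∃ Nim : ι → Matrix (Fin 2) (Fin 2) ℝ,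
    Nim = fun k => (N k).map Complex.im := ⟨_, rfl⟩
  have htr_re : ∀ k, (Nre k).trace = 0 := fun k => by
    have h0 := hN k
    rw [Matrix.trace_fin_two] at h0 ⊢
    subst hNre
    simp only [Matrix.map_apply]
    rw [← Complex.add_re, h0, Complex.zero_re]
  have htr_im : ∀ k, (Nim k).trace = 0 := fun k => by
    have h0 := hN k
    rw [Matrix.trace_fin_two] at h0 ⊢
    subst hNim
    simp only [Matrix.map_apply]
    rw [← Complex.add_im, h0, Complex.zero_im]
  have hre := mem_span_realBlocks_of_forall_trace_eq_zero H hn ψ hself σ hint b hb Nre htr_re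
  have him := mem_span_realBlocks_of_forall_trace_eq_zero H hn ψ hself σ hint b hb Nim htr_im
  -- complexification of the real span lands in the complex span of the blocks of `Lie Hdg`
  have hΦ : ∀ A ∈ Submodule.span ℝ (realBlocks hint b '' (H.hodgeLie : Set (Module.End ℚ V))),
      (fun k => (A k).map (algebraMap ℝ ℂ)) ∈ Submodule.span ℂ
        ((fun X : Module.End ℚ V => blockMat hint b (X.baseChange ℂ)) '' (H.hodgeLie : Set _)) := by
    intro A hA
    induction hA using Submodule.span_induction with
    | mem A hA =>
      obtain ⟨X, hX, rfl⟩ := hA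
      rw [realBlocks_map hint b hb X]
      exact Submodule.subset_span ⟨X, hX, rfl⟩
    | zero =>
      have h0 : (fun k => ((0 : ι → Matrix (Fin 2) (Fin 2) ℝ) k).map (algebraMap ℝ ℂ)) = 0 := by
        funext k
        rw [Pi.zero_apply, Pi.zero_apply, ← RingHom.mapMatrix_apply, map_zero]
      rw [h0]
      exact Submodule.zero_mem _
    | add A A' _ _ hA hA' =>
      have hadd : (fun k => ((A + A') k).map (algebraMap ℝ ℂ)) =
          (fun k => (A k).map (algebraMap ℝ ℂ)) + fun k => (A' k).map (algebraMap ℝ ℂ) := by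
        funext k
        rw [Pi.add_apply, Pi.add_apply, ← RingHom.mapMatrix_apply, map_add, RingHom.mapMatrix_apply,
          RingHom.mapMatrix_apply]
      rw [hadd]
      exact Submodule.add_mem _ hA hA'
    | smul r A _ hA =>
      have hsmul : (fun k => ((r • A) k).map (algebraMap ℝ ℂ)) =
          (r : ℂ) • fun k => (A k).map (algebraMap ℝ ℂ) := by
        funext k
        refine Matrix.ext fun a c => ?_
        simp only [Pi.smul_apply, Matrix.map_apply, Matrix.smul_apply, smul_eq_mul,
          Complex.coe_algebraMap, Complex.ofReal_mul]
      rw [hsmul]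
      exact Submodule.smul_mem _ (r : ℂ) hA
  -- `N` lies in that complex span
  have hNmem : N ∈ Submodule.span ℂ
      ((fun X : Module.End ℚ V => blockMat hint b (X.baseChange ℂ)) '' (H.hodgeLie : Set _)) := by
    have hdec : N = (fun k => (Nre k).map (algebraMap ℝ ℂ)) +
        Complex.I • (fun k => (Nim k).map (algebraMap ℝ ℂ)) := by
      funext k
      ext a c
      simp only [hNre, hNim, Pi.add_apply, Pi.smul_apply, Matrix.add_apply, Matrix.smul_apply,
        Matrix.map_apply, Complex.coe_algebraMap, smul_eq_mul]
      rw [mul_comm, Complex.re_add_im]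
    rw [hdec]
    exact Submodule.add_mem _ (hΦ _ hre) (Submodule.smul_mem _ _ (hΦ _ him))
  -- re-assemble
  have key : ∀ M ∈ Submodule.span ℂ
      ((fun X : Module.End ℚ V => blockMat hint b (X.baseChange ℂ)) '' (H.hodgeLie : Set _)),
      assemble hint b M ∈ H.hodgeLieC := by
    intro M hM
    induction hM using Submodule.span_induction with
    | mem M hM =>
      obtain ⟨X, hX, rfl⟩ := hM
      rw [assemble_blockMat hint b (mapsTo_baseChange_of_mem_hodgeLie H σ hX)]
      exact H.baseChange_mem_hodgeLieC hX
    | zero => rw [map_zero]; exact Submodule.zero_mem _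
    | add M M' _ _ hM hM' => rw [map_add]; exact Submodule.add_mem _ hM hM'
    | smul c M _ hM => rw [map_smul]; exact Submodule.smul_mem _ c hM
  exact key _ hNmem

omit [Module.Finite ℚ V] [HodgeTensorFacts.{u, u}] [Fintype ι] [DecidableEq ι] in
/-- An operator commuting with `End_Hdg(V) ⊗ ℂ` preserves every block. [cite: Huybrechts2016K3, Rem. 3.3.14 (iii)] -/
theorem mapsTo_eigenBlock_of_commute (H : HodgeStructure V n) (τ : H.endAlg →+* ℂ)
    {Y : Module.End ℂ (ℂ ⊗[ℚ] V)}
    (hcomm : ∀ a : H.endAlg,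
      Y * (a : Module.End ℚ V).baseChange ℂ = (a : Module.End ℚ V).baseChange ℂ * Y) :
    Set.MapsTo Y (H.eigenBlock τ) (H.eigenBlock τ) := by
  intro x hx
  have hx' := (H.mem_eigenBlock_iff τ x).1 hx
  refine (H.mem_eigenBlock_iff τ (Y x)).2 fun a => ?_
  rw [← Module.End.mul_apply, ← hcomm a, Module.End.mul_apply, hx' a, map_smul]

omit [Module.Finite ℚ V] [HodgeTensorFacts.{u, u}] [Fintype ι] in
/-- Conversely, an operator preserving every block of an internal block decomposition commutes with
`End_Hdg(V) ⊗ ℂ` (each `a_ℂ` is the scalar `σ_i(a)` on `T_{σ_i}`). [cite: Huybrechts2016K3, Rem. 3.3.14 (iii)] -/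
theorem commute_of_mapsTo_eigenBlock (H : HodgeStructure V n) (σ : ι → (H.endAlg →+* ℂ))
    (hint : DirectSum.IsInternal fun i => H.eigenBlock (σ i)) {Y : Module.End ℂ (ℂ ⊗[ℚ] V)}
    (hYT : ∀ i, Set.MapsTo Y (H.eigenBlock (σ i)) (H.eigenBlock (σ i))) (a : H.endAlg) :
    Y * (a : Module.End ℚ V).baseChange ℂ = (a : Module.End ℚ V).baseChange ℂ * Y := by
  refine LinearMap.ext fun x => ?_
  have hx : x ∈ ⨆ i, H.eigenBlock (σ i) := by
    rw [hint.submodule_iSup_eq_top]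
    exact Submodule.mem_top
  induction hx using Submodule.iSup_induction' with
  | mem i x hx =>
    rw [Module.End.mul_apply, Module.End.mul_apply, (H.mem_eigenBlock_iff (σ i) x).1 hx a,
      (H.mem_eigenBlock_iff (σ i) (Y x)).1 (hYT i hx) a, map_smul]
  | zero => simp
  | add x y _ _ hx hy => rw [map_add, map_add, hx, hy]

/-- **Main step (block-basis form).** With real block bases: a `ℂ`-linear endomorphism of `V_ℂ`
preserving the blocks and skew for `ψ_ℂ` lies in `Lie Hdg(H) ⊗ ℂ` — its blocks are trace-free
(`trace_blockMat_eq_zero`), so `assemble_mem_hodgeLieC_of_forall_trace_eq_zero` applies to them and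
re-assembles the operator. [cite: Hazama1983, §3 (pp. 305–306)] [cite: Ribet1983, Thm. 0–1] -/
theorem mem_hodgeLieC_of_mapsTo_of_skew_aux (H : HodgeStructure V n) (hn : Odd n)
    (ψ : H.Polarization)
    (hself : ∀ a : H.endAlg,
      LinearMap.IsAdjointPair ψ.form ψ.form (a : Module.End ℚ V) (a : Module.End ℚ V))
    (σ : ι → (H.endAlg →+* ℂ)) (hint : DirectSum.IsInternal fun i => H.eigenBlock (σ i))
    (b : ∀ i, Module.Basis (Fin 2) ℂ (H.eigenBlock (σ i)))
    (hb : ∀ i a, conj (b i a : ℂ ⊗[ℚ] V) = b i a) {Y : Module.End ℂ (ℂ ⊗[ℚ] V)}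
    (hYT : ∀ i, Set.MapsTo Y (H.eigenBlock (σ i)) (H.eigenBlock (σ i)))
    (hskew : ∀ x y, ψ.form.baseChange ℂ (Y x) y + ψ.form.baseChange ℂ x (Y y) = 0) :
    Y ∈ H.hodgeLieC := by
  rw [← assemble_blockMat hint b hYT]
  exact assemble_mem_hodgeLieC_of_forall_trace_eq_zero H hn ψ hself σ hint b hb _
    (trace_blockMat_eq_zero H hn ψ hself σ hint b hYT hskew)

omit [Module.Finite ℚ V] [HodgeTensorFacts.{u, u}] [Fintype ι] [DecidableEq ι] in
/-- **Real block bases exist**: if each `σ_i` is a real character and each block `T_{σ_i}` is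
two-dimensional, there are bases `(b_i 0, b_i 1)` of the blocks consisting of real vectors
(`exists_basis_conj_eq_self`: `T_σ` is `conj`-stable for real `σ`). [cite: DeligneHodgeII1971, 2.1.4–2.1.5] -/
theorem exists_real_blockBasis (H : HodgeStructure V n) (σ : ι → (H.endAlg →+* ℂ))
    (hreal : ∀ i, (starRingEnd ℂ).comp (σ i) = σ i)
    (h2 : ∀ i, Module.finrank ℂ (H.eigenBlock (σ i)) = 2) :
    ∃ b : ∀ i, Module.Basis (Fin 2) ℂ (H.eigenBlock (σ i)), ∀ i a, conj (b i a : ℂ ⊗[ℚ] V) = b i a := by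
  have key : ∀ i, ∃ b : Module.Basis (Fin 2) ℂ (H.eigenBlock (σ i)), ∀ a, conj (b a : ℂ ⊗[ℚ] V) = b a := by
    intro i
    have hst : ∀ x ∈ H.eigenBlock (σ i), conj x ∈ H.eigenBlock (σ i) := fun x hx => by
      have h := H.conj_mem_eigenBlock hx
      rwa [hreal i] at h
    obtain ⟨J, B, hB⟩ := exists_basis_conj_eq_self (H.eigenBlock (σ i)) hst
    haveI : Module.Finite ℂ (H.eigenBlock (σ i)) := Module.finite_of_finrank_eq_succ (h2 i)
    haveI : Fintype J := FiniteDimensional.fintypeBasisIndex B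
    have hcard : Fintype.card J = 2 := by rw [← Module.finrank_eq_card_basis B, h2 i]
    exact ⟨B.reindex (Fintype.equivFinOfCardEq hcard), fun a => by
      rw [Module.Basis.reindex_apply]; exact hB _⟩
  choose b hb using key
  exact ⟨b, hb⟩

/-- **Theorem (the complexified Lie algebra of the Hodge group is `⊕_σ 𝔰𝔩(T_σ)`; Hazama 1983 §3,
Ribet 1983).** Let `H` be a polarizable `ℚ`-Hodge structure of ODD weight `n` on a finite-dimensional
`V`, `ψ` a polarization for which EVERY Hodge endomorphism is self-adjoint (Rosati involution trivial
on `E = End_Hdg(V)` — e.g. `E` a totally real field, type I), and `σ_i : E → ℂ` (`i ∈ ι`) REAL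
characters whose eigenblocks `T_{σ_i} ⊆ V_ℂ` are two-dimensional and form an internal direct sum
`V_ℂ = ⊕_i T_{σ_i}` (for `H = H¹(X, ℚ)` of an abelian variety `X` with `End⁰(X) = E` totally real
of degree `dim X`: the real places of `E`; Hazama 1983 §3, "`dim_ℂ V_i = 2` for all `i`"). Then
`Y ∈ End_ℂ(V_ℂ)` lies in `Lie Hdg(H) ⊗ ℂ` if and only if `Y` commutes with `E ⊗ ℂ` and is
`ψ_ℂ`-skew — i.e. `Lie Hdg(H)_ℂ = ⊕_i 𝔰𝔭(T_{σ_i}, ψ_{σ_i}) = ⊕_i 𝔰𝔩(T_{σ_i})`, Hazama's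
"`𝔥 = 𝔰𝔩₂ × ⋯ × 𝔰𝔩₂` (k times) where the `i`-th component acts on `V_i ⊕ ⋯ ⊕ V_i` diagonally"
(§3 p. 306, via Ribet's lemma Prop. (2.6) and Goursat Lemma (3.1)), equivalently
`Hg(X) = R_{E/ℚ} SL_{2,E} = Sp_E(V, ψ)` (Ribet 1983, Thm. 0–1 for relative dimension one). The
direction `→` holds for every Hodge structure (`commute_baseChange_of_mem_hodgeLieC`,
`formBaseChange_skew_of_mem_hodgeLieC`). [cite: Hazama1983, Thm. (1.1), Prop. (2.6), §3 (pp. 305–306), Lemma (3.1)]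
[cite: Ribet1983, Thm. 0–1] [cite: MoonenZarhin1999LowDim, §3 (3.1)] -/
theorem mem_hodgeLieC_iff_commute_and_skew (H : HodgeStructure V n) (hn : Odd n)
    (ψ : H.Polarization)
    (hself : ∀ a : H.endAlg,
      LinearMap.IsAdjointPair ψ.form ψ.form (a : Module.End ℚ V) (a : Module.End ℚ V))
    (σ : ι → (H.endAlg →+* ℂ)) (hreal : ∀ i, (starRingEnd ℂ).comp (σ i) = σ i)
    (hint : DirectSum.IsInternal fun i => H.eigenBlock (σ i))
    (h2 : ∀ i, Module.finrank ℂ (H.eigenBlock (σ i)) = 2) (Y : Module.End ℂ (ℂ ⊗[ℚ] V)) :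
    Y ∈ H.hodgeLieC ↔
      (∀ a : H.endAlg,
        Y * (a : Module.End ℚ V).baseChange ℂ = (a : Module.End ℚ V).baseChange ℂ * Y) ∧
      (∀ x y, ψ.form.baseChange ℂ (Y x) y + ψ.form.baseChange ℂ x (Y y) = 0) := by
  constructor
  · intro hY
    refine ⟨fun a => H.commute_baseChange_of_mem_hodgeLieC hY a, fun x y => ?_⟩
    rw [formBaseChange_skew_of_mem_hodgeLieC ψ hY x y, neg_add_cancel]
  · rintro ⟨hcomm, hskew⟩
    obtain ⟨b, hb⟩ := exists_real_blockBasis H σ hreal h2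
    exact mem_hodgeLieC_of_mapsTo_of_skew_aux H hn ψ hself σ hint b hb
      (fun i => mapsTo_eigenBlock_of_commute H (σ i) hcomm) hskew

/-- **Block form of the theorem**: under the same hypotheses, `Y ∈ Lie Hdg(H) ⊗ ℂ` iff `Y`
preserves every block `T_{σ_i}` and is `ψ_ℂ`-skew (`Lie Hdg(H)_ℂ = ⊕_i 𝔰𝔭(T_{σ_i}) = ⊕_i 𝔰𝔩₂`).
[cite: Hazama1983, §3 (pp. 305–306)] [cite: Ribet1983, Thm. 0–1] -/
theorem mem_hodgeLieC_iff_mapsTo_and_skew (H : HodgeStructure V n) (hn : Odd n)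
    (ψ : H.Polarization)
    (hself : ∀ a : H.endAlg,
      LinearMap.IsAdjointPair ψ.form ψ.form (a : Module.End ℚ V) (a : Module.End ℚ V))
    (σ : ι → (H.endAlg →+* ℂ)) (hreal : ∀ i, (starRingEnd ℂ).comp (σ i) = σ i)
    (hint : DirectSum.IsInternal fun i => H.eigenBlock (σ i))
    (h2 : ∀ i, Module.finrank ℂ (H.eigenBlock (σ i)) = 2) (Y : Module.End ℂ (ℂ ⊗[ℚ] V)) :
    Y ∈ H.hodgeLieC ↔
      (∀ i, Set.MapsTo Y (H.eigenBlock (σ i)) (H.eigenBlock (σ i))) ∧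
      (∀ x y, ψ.form.baseChange ℂ (Y x) y + ψ.form.baseChange ℂ x (Y y) = 0) := by
  rw [mem_hodgeLieC_iff_commute_and_skew H hn ψ hself σ hreal hint h2]
  exact ⟨fun ⟨hc, hs⟩ => ⟨fun i => mapsTo_eigenBlock_of_commute H (σ i) hc, hs⟩,
    fun ⟨hT, hs⟩ => ⟨commute_of_mapsTo_eigenBlock H σ hint hT, hs⟩⟩

omit [Fintype ι] [DecidableEq ι] in
/-- `X ∈ Lie Hdg(H)` iff `X_ℂ ∈ Lie Hdg(H) ⊗ ℂ` (the complexified Hodge tensors are the images of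
the rational ones under the injective comparison map `tensorSpaceToBaseChange`).
[cite: Huybrechts2016K3, §3.3.4 (p. 66)] -/
theorem mem_hodgeLie_iff_baseChange_mem_hodgeLieC (H : HodgeStructure V n) (X : Module.End ℚ V) :
    X ∈ H.hodgeLie ↔ X.baseChange ℂ ∈ H.hodgeLieC := by
  refine ⟨fun hX => H.baseChange_mem_hodgeLieC hX, fun hXC => ?_⟩
  rw [mem_hodgeLie_iff]
  intro a b p hab t ht
  have h := (H.mem_hodgeLieC_iff _).1 hXC a b p hab t ht
  rw [tensorDerivation_baseChange_tensorSpaceToBaseChange] at h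
  exact tensorSpaceToBaseChange_injective V a b (by rw [h, map_zero])

/-- **Theorem (`Lie Hdg(H) = 𝔰𝔭_E(V, ψ)`, rational form; Hazama 1983 Thm. (1.1)/§3, Ribet 1983).**
Under the hypotheses of `mem_hodgeLieC_iff_commute_and_skew`, a rational endomorphism `X` of `V`
lies in the Lie algebra of the Hodge group if and only if it commutes with every Hodge
endomorphism and is `ψ`-skew: `Lie Hdg(H) = {X ∈ End_E(V) : ψ(Xv, w) + ψ(v, Xw) = 0}`, the Lie
algebra of `R_{E/ℚ} Sp_E(V, ψ_E)` (`= R_{E/ℚ} SL₂` when `dim_E V = 2`): "`Hg(A) = R_{E/ℚ} SL₂`"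
for an abelian variety with `End⁰(A) = E` totally real, `[E : ℚ] = dim A` (Hazama 1983 §3;
Ribet 1983 Thm. 0–1; the Hodge group is then as large as the endomorphisms and the polarization
allow). [cite: Hazama1983, Thm. (1.1) and §3 (pp. 305–306)] [cite: Ribet1983, Thm. 0–1]
[cite: MoonenZarhin1999LowDim, §3 (3.1)] -/
theorem mem_hodgeLie_iff_commute_and_skew (H : HodgeStructure V n) (hn : Odd n)
    (ψ : H.Polarization)
    (hself : ∀ a : H.endAlg,
      LinearMap.IsAdjointPair ψ.form ψ.form (a : Module.End ℚ V) (a : Module.End ℚ V))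
    (σ : ι → (H.endAlg →+* ℂ)) (hreal : ∀ i, (starRingEnd ℂ).comp (σ i) = σ i)
    (hint : DirectSum.IsInternal fun i => H.eigenBlock (σ i))
    (h2 : ∀ i, Module.finrank ℂ (H.eigenBlock (σ i)) = 2) (X : Module.End ℚ V) :
    X ∈ H.hodgeLie ↔
      (∀ a : H.endAlg, X * (a : Module.End ℚ V) = (a : Module.End ℚ V) * X) ∧
      (∀ v w, ψ.form (X v) w + ψ.form v (X w) = 0) := by
  constructor
  · intro hX
    exact ⟨fun a => H.commute_of_mem_hodgeLie hX a,
      fun v w => form_apply_add_eq_zero_of_mem_hodgeLie ψ hX v w⟩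
  · rintro ⟨hcomm, hskew⟩
    rw [mem_hodgeLie_iff_baseChange_mem_hodgeLieC,
      mem_hodgeLieC_iff_commute_and_skew H hn ψ hself σ hreal hint h2]
    refine ⟨fun a => ?_, fun x y => ?_⟩
    · rw [← LinearMap.baseChange_mul, hcomm a, LinearMap.baseChange_mul]
    · have hadj : LinearMap.IsAdjointPair ψ.form ψ.form (X : V → V) ((-X : Module.End ℚ V) : V → V) :=
        fun v w => by
          rw [LinearMap.neg_apply, map_neg, ← sub_eq_zero, sub_neg_eq_add]
          exact hskew v w
      rw [isAdjointPair_baseChange (f := X) (g := -X) hadj x y, LinearMap.baseChange_neg,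
        LinearMap.neg_apply, map_neg, neg_add_cancel]

end Hodge

end HodgeStructure

end Literature.AlgebraicGeometry.Motives

end
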